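import Literature.Probability.RandomPlanarGeometry.HexSAWSurfaceWallRenewalSlackTwoClassification
import HarnessLib

/-!
# Irreducible positive wall bridges at slack four: the double dip `D D U D U U` never occurs

[cite: MadrasSlade1993, Section 4.2, Definition 4.2.1 (irreducible bridges, p. 90) and the remark before (4.2.21) (p. 94); Section 1.2,
Definition 1.2.4 (bridges, p. 11)] [cite: Kesten1963SAW, Section 4 (irreducible bridges)]
[cite: EntingJensen2009, Section 7.4.2, Fig. 7.10 (brickwork form of the honeycomb lattice)]
[cite: BeatonBousquetMelouDeGierDuminilCopinGuttmann2014, Section 3.1 (arXiv v5 p. 8: surface visits)]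

Lane module (pub-sawmu, wall-renewal line; companion of the slack-four cars `…SlackFourTwoDown` and `…SlackFourBumpHairpin`,
independent of both). At SLACK FOUR (`n = 6k + 4`, `k` surface visits) an irreducible positive wall bridge with three down steps
`p₁ < p₂ < p₃` and three up steps `r₁ < r₂ < r₃` (`pᵢ < rᵢ`) has its vertical steps in one of the five Dyck orders
`D D D U U U`, `D D U D U U`, `D U D D U U`, `D D U U D U`, `D U D U D U`. This module excludes the DOUBLE DIP `D D U D U U`
(`p₂ < r₁ < p₃ < r₂`: dive, dive, rise, dive, rise, rise) at slack four:

* §1 `dduduu4_runs` — the run analysis of the order `D D U D U U` at ANY length (the slack-two lemma `dduduu_runs` of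
  `…SlackTwoClassification` without its length, visit and numerics clauses): after the first dive at the column `p₁` the walk runs
  with constant velocities `e₁, …, e₅ = ±1` on the rows `−1, −2, −1, −2, −1`, the final wall run goes right; the columns
  `b = ω p₂ 0`, `c = ω r₁ 0`, `d = ω p₃ 0`, `e = ω r₂ 0` are even, the last up column `g = ω r₃ 0` is odd, `r₃` is even, the visit
  count is `⌊p₁/2⌋ + (m − r₃)/2` and the exit abscissa is `X_m = g + (m − r₃ − 1)`;
* §2 `dduduu4_exit` — at slack four the gap and charge counts of `…SixStepRigid` and the visit count leave `g ∈ {p₁ + 2, p₁ + 4}`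
  and `r₃ = m + p₁ − 2k − 1`;
* §3 `dduduu4_frame` (any length, `g > p₁`) — `e > p₁`, `b < g`, `b < e`, and the middle row-`−1` run lies right of the column
  `p₁` (else it stays left of the first run and the second row-`−2` run passes under `ω (p₂+1)`); `dduduu_gap_two_false` (any
  length) — `g = p₁ + 2` is impossible: the middle run then lies right of the column `p₁ + 2` and the first row-`−2` run passes
  under `ω r₂` (the slack-two proof `dduduu_false`, verbatim);
* §4 `dduduu_gap_four_mid`, `dduduu_gap_four` (any length) — `g = p₁ + 4` forces the W-shape: the first run goes LEFT to a column
  `b ≤ p₁ − 1`, the first row-`−2` run goes right to `c = p₁ + 1`, the middle run is the two steps `p₁ + 1 → p₁ + 3` (`p₃ = r₁ + 3`),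
  the second row-`−2` run goes right to a column `e ≥ p₁ + 5`, and the last row-`−1` run comes back left to `p₁ + 4`; counting
  the steps, `r₃ + 2b = p₁ + 2e + 1`. (This shape IS realised at slack six, e.g. by the block
  `R R R D L D R R U R R D R R U L U R` of `ipwb 18` with two visits; so the length must enter, and it enters only here:)
* §5 `dduduu_slack_four_false` — at slack four `r₃ = m + p₁ − 2k − 1 = 4k + 3 + p₁`, so the step count reads `e − b = 2k + 1`
  with `b`, `e` even: the order `D D U D U U` never occurs in `ipwb (6k + 4)` with `k` visits (stated over `stepsD`, `stepsU`
  and the order of the six times only; the profile data of the first dive are recovered from `profile_of_card_stepsD_eq_three`).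

With `three_down_mixed_slack_four` of `…SlackFourBumpHairpin` (whose residual disjunct is exactly this order) a block of
`ipwb (6k+4)` with `k` visits and three down steps is either of order `D D D U U U` or the bump-then-hairpin block `g3b k`; the
combination is left to a successor (this module does not import the pool car).

All statements are over the lane's objects `ipwb`, `visits`, `stepsD`, `stepsU` (`…HexSAWSurfaceWallRenewal`); the general-length
tools `profile_of_card_stepsD_eq_three`, `run_const_velocity`, `runs_disjoint`, `of_mem_stepsD_coord`, `of_mem_stepsU_coord` are
reused from the slack-two modules, and the slack-four numerics from `…SixStepRigid` (`two_mul_visits_add_two_le_apply`,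
`apply_add_card_stepsD_add_four_mul_visits_le`, `card_stepsU_eq_card_stepsD`).

STATUS: lane theorem of the a-idea-1 bridge/renewal lineage (cars 71 `…SixStep`, 73 `…SixStepRigid`, 74a `…SlackTwoFamilies`,
74b `…SecondGap` / `…SlackTwoClassification`, 75 `…IteratedGap`, 76 `…WallOrder`; pool cars 77 `…SlackFourTwoDown`, 79a
`…SlackFourBumpHairpin`); part of the third stratum of the slack-four census `N_{3k+2,k}` («car 79b»). OURS (new in writing,
modest): the W-shape of a double dip whose last rise is four columns right of its first dive, and the exclusion at slack four;
checked against the lane's complete enumeration of the irreducible positive wall bridges of length `6k + 4` with `k` visits for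
`2 ≤ k ≤ 15` (`11, 33, 95, …, 88 645` blocks: none of order `D D U D U U`) and of length `6k + 6`, `k ≤ 8` (double dips occur
there, all with `g ∈ {p₁ + 4, p₁ + 6}`). The printed sources carry the renewal / irreducible-bridge structure (Madras–Slade §1.2,
Definition 1.2.4 (bridges, p. 11); §4.2, Definition 4.2.1 (irreducible bridges, p. 90) and the remark before (4.2.21), p. 94;
Kesten), the brickwork frame of the honeycomb lattice (Enting–Jensen §7.4.2, Fig. 7.10) and the surface-visit statistic (Beaton et
al. §3.1) — none states the run analysis or the exclusion. No budget options: every declaration elaborates within 100 000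
heartbeats on the reference farm.
-/

namespace Literature.Probability.RandomPlanarGeometry.SAW.HexBW.Wall

open Finset Filter Function
open Literature.Probability.LatticeModels Literature.Probability.Percolation SimpleGraph

variable {n : ℕ} {ω : ℕ → Site 2}

/-! ### §0  A private tool -/

/-- A site of `Site 2` is determined by its two coordinates. [folklore] -/
private theorem site_ext_dd {p q : Site 2} (h0 : p 0 = q 0) (h1 : p 1 = q 1) : p = q := by
  ext i; fin_cases i; exacts [h0, h1]

/-! ### §1  The order `D D U D U U` at any length: the runs -/

/-- **The runs of a `D D U D U U` block** (any length `m`; down steps `p₁ < p₂ < p₃`, up steps `r₁ < r₂ < r₃`, `p₂ < r₁ < p₃ < r₂`):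
after the first dive at the column `p₁` the walk runs with constant velocities `e₁, …, e₅ = ±1` on the rows `−1, −2, −1, −2, −1`
(times `p₁+1 … p₂`, `p₂+1 … r₁`, `r₁+1 … p₃`, `p₃+1 … r₂`, `r₂+1 … r₃`); the columns `ω p₂ 0`, `ω r₁ 0`, `ω p₃ 0`, `ω r₂ 0` are
even and positive, the last up column `ω r₃ 0` is odd, `r₃ < m` is even, the middle row-`−1` run has a step, the visit count is
`⌊p₁/2⌋ + (m − r₃)/2` (no visit strictly between the first dive and the last rise) and, the final wall run going right, the exit
abscissa is `X_m = ω r₃ 0 + (m − r₃ − 1)`. (The slack-two lemma `dduduu_runs`, verbatim up to its numerics.)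
[cite: MadrasSlade1993, §4.2, Definition 4.2.1 (p. 90); §1.2, Definition 1.2.4 (p. 11)] [cite: EntingJensen2009, §7.4.2, Fig. 7.10] -/
theorem dduduu4_runs {m : ℕ} (hω : ω ∈ ipwb m)
    {p₁ p₂ p₃ r₁ r₂ r₃ : ℕ} (hD : stepsD m ω = {p₁, p₂, p₃}) (hU : stepsU m ω = {r₁, r₂, r₃}) (h12 : p₁ < p₂)
    (ho1 : p₂ < r₁) (ho2 : r₁ < p₃) (ho3 : p₃ < r₂) (hr23 : r₂ < r₃) (hp1 : 1 ≤ p₁)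
    (hR0 : ∀ i, i ≤ p₁ → ω i 0 = i ∧ ω i 1 = 0) (hP1x : ω (p₁ + 1) 0 = p₁) (hP1y : ω (p₁ + 1) 1 = -1)
    (hhor : ∀ i, i < m → i ∉ stepsD m ω → i ∉ stepsU m ω →
      ω (i + 1) 1 = ω i 1 ∧ (ω (i + 1) 0 = ω i 0 + 1 ∨ ω (i + 1) 0 = ω i 0 - 1)) :
    ∃ e₁ e₂ e₃ e₄ e₅ : ℤ, (e₁ = 1 ∨ e₁ = -1) ∧ (e₂ = 1 ∨ e₂ = -1) ∧ (e₃ = 1 ∨ e₃ = -1) ∧ (e₄ = 1 ∨ e₄ = -1) ∧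
      (e₅ = 1 ∨ e₅ = -1) ∧
      (∀ i, p₁ + 1 ≤ i → i ≤ p₂ → ω i 0 = p₁ + e₁ * ((i - (p₁ + 1) : ℕ) : ℤ) ∧ ω i 1 = -1) ∧
      (∀ i, p₂ + 1 ≤ i → i ≤ r₁ → ω i 0 = ω p₂ 0 + e₂ * ((i - (p₂ + 1) : ℕ) : ℤ) ∧ ω i 1 = -2) ∧
      (∀ i, r₁ + 1 ≤ i → i ≤ p₃ → ω i 0 = ω r₁ 0 + e₃ * ((i - (r₁ + 1) : ℕ) : ℤ) ∧ ω i 1 = -1) ∧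
      (∀ i, p₃ + 1 ≤ i → i ≤ r₂ → ω i 0 = ω p₃ 0 + e₄ * ((i - (p₃ + 1) : ℕ) : ℤ) ∧ ω i 1 = -2) ∧
      (∀ i, r₂ + 1 ≤ i → i ≤ r₃ → ω i 0 = ω r₂ 0 + e₅ * ((i - (r₂ + 1) : ℕ) : ℤ) ∧ ω i 1 = -1) ∧
      ω p₂ 0 % 2 = 0 ∧ ω r₁ 0 % 2 = 0 ∧ ω p₃ 0 % 2 = 0 ∧ ω r₂ 0 % 2 = 0 ∧ ω r₃ 0 % 2 = 1 ∧
      0 < ω p₂ 0 ∧ 0 < ω r₁ 0 ∧ 0 < ω p₃ 0 ∧ 0 < ω r₂ 0 ∧ r₁ + 2 ≤ p₃ ∧ r₃ < m ∧ r₃ % 2 = 0 ∧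
      visits m ω = p₁ / 2 + (m - r₃) / 2 ∧ ω m 0 = ω r₃ 0 + ((m - (r₃ + 1) : ℕ) : ℤ) := by
  classical
  obtain ⟨hpw, -, -⟩ := mem_ipwb.1 hω
  obtain ⟨hw, hb⟩ := mem_pwb.1 hpw
  obtain ⟨ha, -⟩ := mem_wbr.1 hw
  obtain ⟨hh, hm2, -⟩ := mem_archs.1 ha
  obtain ⟨hs, -⟩ := mem_hpw.1 hh
  obtain ⟨h0, -, hbw, hinj⟩ := mem_saws_iff.1 hs
  have hX0 : ω 0 0 = 0 := by rw [h0]; rfl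
  have hb' : ∀ i, 1 ≤ i → i ≤ m → 0 < ω i 0 ∧ ω i 0 ≤ ω m 0 := fun i h1 h2 => by
    have := hb i h1 h2; rwa [hX0] at this
  have hmem : ∀ i, i ≤ m → i ∈ {i | i ≤ m} := fun i hi => hi
  have hmD : ∀ i, i ∈ stepsD m ω ↔ i = p₁ ∨ i = p₂ ∨ i = p₃ := fun i => by
    rw [hD]; simp only [Finset.mem_insert, Finset.mem_singleton]
  have hmU : ∀ i, i ∈ stepsU m ω ↔ i = r₁ ∨ i = r₂ ∨ i = r₃ := fun i => by
    rw [hU]; simp only [Finset.mem_insert, Finset.mem_singleton]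
  obtain ⟨hpn2, hpx2, hpy2, hppar2⟩ := of_mem_stepsD_coord hbw (i := p₂) ((hmD _).2 (by simp))
  obtain ⟨hpn3, hpx3, hpy3, hppar3⟩ := of_mem_stepsD_coord hbw (i := p₃) ((hmD _).2 (by simp))
  obtain ⟨hrn1, hrx1, hry1, hrpar1⟩ := of_mem_stepsU_coord hbw (i := r₁) ((hmU _).2 (by simp))
  obtain ⟨hrn2, hrx2, hry2, hrpar2⟩ := of_mem_stepsU_coord hbw (i := r₂) ((hmU _).2 (by simp))
  obtain ⟨hrn3, hrx3, hry3, hrpar3⟩ := of_mem_stepsU_coord hbw (i := r₃) ((hmU _).2 (by simp))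
  have hhor' : ∀ i, i < m → i ≠ p₁ → i ≠ p₂ → i ≠ p₃ → i ≠ r₁ → i ≠ r₂ → i ≠ r₃ →
      ω (i + 1) 1 = ω i 1 ∧ (ω (i + 1) 0 = ω i 0 + 1 ∨ ω (i + 1) 0 = ω i 0 - 1) :=
    fun i hi n1 n2 n3 n4 n5 n6 => hhor i hi (by rw [hmD]; omega) (by rw [hmU]; omega)
  -- run 1 on row `−1`
  obtain ⟨e1, he1, hrun1⟩ := run_const_velocity hinj (a := p₁ + 1) (b := p₂) (by omega) (by omega)
    (fun i hi1 hi2 => hhor' i (by omega) (by omega) (by omega) (by omega) (by omega) (by omega) (by omega))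
  have hQy : ω p₂ 1 = -1 := by rw [(hrun1 p₂ (by omega) le_rfl).2, hP1y]
  have hQ1y : ω (p₂ + 1) 1 = -2 := by rw [hpy2, hQy]; rfl
  have hbev : ω p₂ 0 % 2 = 0 := by rw [hpx2, hQ1y] at hppar2; omega
  have hb1 := (hb' p₂ (by omega) (by omega)).1
  -- run 2 on row `−2`
  obtain ⟨e2, he2, hrun2⟩ := run_const_velocity hinj (a := p₂ + 1) (b := r₁) (by omega) (by omega)
    (fun i hi1 hi2 => hhor' i (by omega) (by omega) (by omega) (by omega) (by omega) (by omega) (by omega))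
  have hCy : ω r₁ 1 = -2 := by rw [(hrun2 r₁ (by omega) le_rfl).2, hQ1y]
  have hC1y : ω (r₁ + 1) 1 = -1 := by rw [hry1, hCy]; rfl
  have hcev : ω r₁ 0 % 2 = 0 := by rw [hCy] at hrpar1; omega
  have hc1 := (hb' r₁ (by omega) (by omega)).1
  -- run 3 on row `−1`
  obtain ⟨e3, he3, hrun3⟩ := run_const_velocity hinj (a := r₁ + 1) (b := p₃) (by omega) (by omega)
    (fun i hi1 hi2 => hhor' i (by omega) (by omega) (by omega) (by omega) (by omega) (by omega) (by omega))
  have hDy : ω p₃ 1 = -1 := by rw [(hrun3 p₃ (by omega) le_rfl).2, hC1y]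
  have hD1y : ω (p₃ + 1) 1 = -2 := by rw [hpy3, hDy]; rfl
  have hdev : ω p₃ 0 % 2 = 0 := by rw [hpx3, hD1y] at hppar3; omega
  have hd1 := (hb' p₃ (by omega) (by omega)).1
  -- run 4 on row `−2`
  obtain ⟨e4, he4, hrun4⟩ := run_const_velocity hinj (a := p₃ + 1) (b := r₂) (by omega) (by omega)
    (fun i hi1 hi2 => hhor' i (by omega) (by omega) (by omega) (by omega) (by omega) (by omega) (by omega))
  have hEy : ω r₂ 1 = -2 := by rw [(hrun4 r₂ (by omega) le_rfl).2, hD1y]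
  have hE1y : ω (r₂ + 1) 1 = -1 := by rw [hry2, hEy]; rfl
  have heev : ω r₂ 0 % 2 = 0 := by rw [hEy] at hrpar2; omega
  have he1' := (hb' r₂ (by omega) (by omega)).1
  -- run 5 on row `−1`
  obtain ⟨e5, he5, hrun5⟩ := run_const_velocity hinj (a := r₂ + 1) (b := r₃) (by omega) (by omega)
    (fun i hi1 hi2 => hhor' i (by omega) (by omega) (by omega) (by omega) (by omega) (by omega) (by omega))
  have hSy : ω r₃ 1 = -1 := by rw [(hrun5 r₃ (by omega) le_rfl).2, hE1y]
  have hS1y : ω (r₃ + 1) 1 = 0 := by rw [hry3, hSy]; rfl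
  have hsev : r₃ % 2 = 0 := by have := parity_apply hs (show r₃ ≤ m by omega); rw [hSy] at this; omega
  have hgodd : ω r₃ 0 % 2 = 1 := by rw [hSy] at hrpar3; omega
  -- run 6 on the wall goes right
  obtain ⟨e6, he6, hrun6⟩ := run_const_velocity hinj (a := r₃ + 1) (b := m) (by omega) le_rfl
    (fun i hi1 hi2 => hhor' i (by omega) (by omega) (by omega) (by omega) (by omega) (by omega) (by omega))
  obtain rfl : e6 = 1 := by
    rcases he6 with h | rfl
    · exact h
    exfalso
    have hN := (hrun6 m (by omega) le_rfl).1
    have hbn := (hb' (r₃ + 1) (by omega) (by omega)).2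
    rw [hrx3] at hN hbn
    omega
  have hR6 : ∀ j, r₃ + 1 ≤ j → j ≤ m → ω j 0 = ω r₃ 0 + ((j - (r₃ + 1) : ℕ) : ℤ) ∧ ω j 1 = 0 := fun j hj1 hj2 => by
    obtain ⟨hx, hy⟩ := hrun6 j hj1 hj2
    rw [hrx3] at hx; rw [hS1y] at hy
    exact ⟨by rw [hx]; ring, hy⟩
  -- the visit count
  have hvf : visits m ω = p₁ / 2 + (m - r₃) / 2 := by
    have hv1 : visits p₁ ω = p₁ / 2 := visits_eq_div_two_of_wall (fun i _ hi2 => (hR0 i hi2).2)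
    have hv2 : visits r₃ ω = visits p₁ ω := by
      have := visits_add_eq_left (k := p₁) (b := r₃ - p₁) (ζ := ω) (fun j hj1 hj2 => ?_)
      · rwa [show p₁ + (r₃ - p₁) = r₃ by omega] at this
      rintro ⟨-, hy⟩
      rcases Nat.lt_or_ge (p₁ + j) (p₂ + 1) with hj | hj
      · have := (hrun1 (p₁ + j) (by omega) (by omega)).2; rw [hP1y] at this; omega
      rcases Nat.lt_or_ge (p₁ + j) (r₁ + 1) with hja | hja
      · have := (hrun2 (p₁ + j) hj (by omega)).2; rw [hQ1y] at this; omega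
      rcases Nat.lt_or_ge (p₁ + j) (p₃ + 1) with hjb | hjb
      · have := (hrun3 (p₁ + j) hja (by omega)).2; rw [hC1y] at this; omega
      rcases Nat.lt_or_ge (p₁ + j) (r₂ + 1) with hjc | hjc
      · have := (hrun4 (p₁ + j) hjb (by omega)).2; rw [hD1y] at this; omega
      · have := (hrun5 (p₁ + j) hjc (by omega)).2; rw [hE1y] at this; omega
    have hv3 : visits m ω = visits r₃ ω + visits (m - r₃) (fun _ => (0 : Site 2)) := by
      have := visits_add (a := r₃) (b := m - r₃) (ζ := ω) (ξ := fun _ => (0 : Site 2)) hsev (fun j hj1 hj2 => ?_)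
      · rwa [show r₃ + (m - r₃) = m by omega] at this
      rw [(hR6 (r₃ + j) (by omega) (by omega)).2]; rfl
    have hv4 : visits (m - r₃) (fun _ => (0 : Site 2)) = (m - r₃) / 2 := visits_eq_div_two_of_wall (fun i _ _ => rfl)
    rw [hv3, hv2, hv1, hv4]
  have hX : ω m 0 = ω r₃ 0 + ((m - (r₃ + 1) : ℕ) : ℤ) := (hR6 m (by omega) le_rfl).1
  -- the middle row-`−1` run has a step (else the second dive undoes the first rise)
  have hr2 : r₁ + 2 ≤ p₃ := by
    by_contra h
    obtain rfl : p₃ = r₁ + 1 := by omega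
    have := hinj (hmem (r₁ + 1 + 1) (by omega)) (hmem r₁ (by omega))
      (site_ext_dd (by rw [hpx3, hrx1]) (by rw [hD1y, hCy]))
    omega
  refine ⟨e1, e2, e3, e4, e5, he1, he2, he3, he4, he5,
    fun i hi1 hi2 => ⟨by rw [(hrun1 i hi1 hi2).1, hP1x], by rw [(hrun1 i hi1 hi2).2, hP1y]⟩,
    fun i hi1 hi2 => ⟨by rw [(hrun2 i hi1 hi2).1, hpx2], by rw [(hrun2 i hi1 hi2).2, hQ1y]⟩,
    fun i hi1 hi2 => ⟨by rw [(hrun3 i hi1 hi2).1, hrx1], by rw [(hrun3 i hi1 hi2).2, hC1y]⟩,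
    fun i hi1 hi2 => ⟨by rw [(hrun4 i hi1 hi2).1, hpx3], by rw [(hrun4 i hi1 hi2).2, hD1y]⟩,
    fun i hi1 hi2 => ⟨by rw [(hrun5 i hi1 hi2).1, hrx2], by rw [(hrun5 i hi1 hi2).2, hE1y]⟩,
    hbev, hcev, hdev, heev, hgodd, hb1, hc1, hd1, he1', hr2, hrn3, hsev, hvf, hX⟩

/-! ### §2  Slack four: the last rise is two or four columns right of the first dive -/

/-- **The last up column at slack four.** For a `D D U D U U` block of length `m = 6k + 4` with `k` visits the gap count
`2v + 2 ≤ X_m` and the charge count `X_m + #down + 4v ≤ m + 4` of `…SixStepRigid` give `2k + 2 ≤ X_m ≤ 2k + 5`; the visit count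
`k = ⌊p₁/2⌋ + (m − r₃)/2` (`p₁` odd, `r₃` even) gives `r₃ = m + p₁ − 2k − 1`, so the final wall run has `2k − p₁` steps and the
last up step is at the odd column `ω r₃ 0 = X_m − 2k + p₁ ∈ {p₁ + 2, p₁ + 4}`. (At slack two only `p₁ + 2` remains: `dduduu_runs`.)
[cite: MadrasSlade1993, §4.2, remark before (4.2.21) (p. 94)] [cite: EntingJensen2009, §7.4.2, Fig. 7.10] -/
theorem dduduu4_exit {k m p₁ p₂ p₃ r₃ : ℕ} (hk : 2 ≤ k) (hm : m = 6 * k + 4) (hω : ω ∈ ipwb m) (hv : visits m ω = k)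
    (hD : stepsD m ω = {p₁, p₂, p₃}) (h12 : p₁ < p₂) (h23 : p₂ < p₃) (hpodd : p₁ % 2 = 1) (hsev : r₃ % 2 = 0)
    (hsm : r₃ < m) (hgodd : ω r₃ 0 % 2 = 1) (hvf : visits m ω = p₁ / 2 + (m - r₃) / 2)
    (hX : ω m 0 = ω r₃ 0 + ((m - (r₃ + 1) : ℕ) : ℤ)) :
    (ω r₃ 0 = p₁ + 2 ∨ ω r₃ 0 = p₁ + 4) ∧ r₃ + 2 * k + 1 = m + p₁ := by
  classical
  have hcard : #(stepsD m ω) = 3 := by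
    rw [hD, Finset.card_insert_of_notMem (by simp; omega), Finset.card_insert_of_notMem (by simp; omega),
      Finset.card_singleton]
  have hG := two_mul_visits_add_two_le_apply hω (by omega)
  have hC := apply_add_card_stepsD_add_four_mul_visits_le hω (by omega)
  rw [hv] at hG hC
  rw [hcard] at hC
  rw [hvf] at hv
  omega

/-! ### §3  The frame of a double dip, and the gap two -/

/-- **The frame of a `D D U D U U` block** (any length; `b = ω p₂ 0`, `c = ω r₁ 0`, `d = ω p₃ 0`, `e = ω r₂ 0`, `g = ω r₃ 0 > p₁`):
`e > p₁` (else the last row-`−1` run, rising to `g`, crosses the column `p₁` of `ω (p₁+1)`), `b < g` (else `ω r₃` lies on the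
first run), `b < e` (else the last run passes `ω p₂`), and the middle row-`−1` run lies right of the column `p₁`: if it started
left of `p₁` it would end left of `p₁` and left of `b` (it cannot pass under the first run's sites), and the second row-`−2` run,
from `d < b` to `e > b`, would pass the site `ω (p₂+1) = (b, −2)`; so `c > p₁`, and then `d > p₁` too.
[cite: MadrasSlade1993, §4.2, Definition 4.2.1 (p. 90); §1.2, Definition 1.2.4 (p. 11)] [cite: EntingJensen2009, §7.4.2, Fig. 7.10] -/
theorem dduduu4_frame {m : ℕ} (hω : ω ∈ ipwb m)
    {p₁ p₂ p₃ r₁ r₂ r₃ : ℕ} (hD : stepsD m ω = {p₁, p₂, p₃}) (hU : stepsU m ω = {r₁, r₂, r₃}) (h12 : p₁ < p₂)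
    (ho1 : p₂ < r₁) (ho2 : r₁ < p₃) (ho3 : p₃ < r₂) (hr23 : r₂ < r₃) (hp1 : 1 ≤ p₁) (hpodd : p₁ % 2 = 1)
    (hR0 : ∀ i, i ≤ p₁ → ω i 0 = i ∧ ω i 1 = 0) (hP1x : ω (p₁ + 1) 0 = p₁) (hP1y : ω (p₁ + 1) 1 = -1)
    (hhor : ∀ i, i < m → i ∉ stepsD m ω → i ∉ stepsU m ω →
      ω (i + 1) 1 = ω i 1 ∧ (ω (i + 1) 0 = ω i 0 + 1 ∨ ω (i + 1) 0 = ω i 0 - 1))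
    (hgp : (p₁ : ℤ) + 1 ≤ ω r₃ 0) :
    (p₁ : ℤ) + 1 ≤ ω r₂ 0 ∧ ω p₂ 0 < ω r₃ 0 ∧ ω p₂ 0 < ω r₂ 0 ∧ (p₁ : ℤ) + 1 ≤ ω r₁ 0 ∧ (p₁ : ℤ) + 1 ≤ ω p₃ 0 := by
  obtain ⟨hpw, -, -⟩ := mem_ipwb.1 hω
  obtain ⟨hw, -⟩ := mem_pwb.1 hpw
  have hinj : Set.InjOn ω {i | i ≤ m} :=
    (mem_saws_iff.1 (mem_hpw.1 (mem_archs.1 (mem_wbr.1 hw).1).1).1).2.2.2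
  obtain ⟨e₁, e₂, e₃, e₄, e₅, he₁, he₂, he₃, he₄, he₅, hrun1, hrun2, hrun3, hrun4, hrun5, hbev, hcev, hdev, heev, -,
    hb1, hc1, hd1, he1, hr2, hsm, -, -, -⟩ := dduduu4_runs hω hD hU h12 ho1 ho2 ho3 hr23 hp1 hR0 hP1x hP1y hhor
  have hb := (hrun1 p₂ (by omega) le_rfl).1
  have hc := (hrun2 r₁ (by omega) le_rfl).1
  have hd := (hrun3 p₃ (by omega) le_rfl).1
  have he := (hrun4 r₂ (by omega) le_rfl).1
  have hg' := (hrun5 r₃ (by omega) le_rfl).1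
  have h3s : ω (r₁ + 1) 0 = ω r₁ 0 := by simpa using (hrun3 (r₁ + 1) le_rfl (by omega)).1
  have hd15 := runs_disjoint hinj (show p₂ < r₂ + 1 by omega) hsm.le hrun1 hrun5
  have hd13 := runs_disjoint hinj (show p₂ < r₁ + 1 by omega) (show p₃ ≤ m by omega) hrun1 hrun3
  have hd24 := runs_disjoint hinj (show r₁ < p₃ + 1 by omega) (show r₂ ≤ m by omega) hrun2 hrun4
  -- `e > p₁`: else run 5, rising to `g > p₁`, crosses the column `p₁` of `ω (p₁+1)`
  have hep : (p₁ : ℤ) + 1 ≤ ω r₂ 0 := by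
    by_contra hlt
    rcases he₅ with rfl | rfl
    · refine hd15 (p₁ + 1) (r₂ + 1 + (p₁ - (ω r₂ 0).toNat)) le_rfl (by omega) (by omega) (by omega) ?_
      rw [hP1x, (hrun5 (r₂ + 1 + (p₁ - (ω r₂ 0).toNat)) (by omega) (by omega)).1]; omega
    · omega
  -- `b < g`: else the landing column `g > p₁` of the last rise is a column of run 1, on the same row
  have hbg : ω p₂ 0 < ω r₃ 0 := by
    by_contra hle
    obtain rfl : e₁ = 1 := by rcases he₁ with rfl | rfl <;> omega
    refine hd15 (p₁ + 1 + ((ω r₃ 0).toNat - p₁)) r₃ (by omega) (by omega) (by omega) le_rfl ?_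
    rw [(hrun1 (p₁ + 1 + ((ω r₃ 0).toNat - p₁)) (by omega) (by omega)).1]; omega
  -- `b < e`: else run 5, from `e ≤ b` up to `g > b`, passes the column `b` of `ω p₂`
  have hbe : ω p₂ 0 < ω r₂ 0 := by
    by_contra hle
    obtain rfl : e₅ = 1 := by rcases he₅ with rfl | rfl <;> omega
    refine hd15 p₂ (r₂ + 1 + ((ω p₂ 0).toNat - (ω r₂ 0).toNat)) (by omega) le_rfl (by omega) (by omega) ?_
    rw [(hrun5 (r₂ + 1 + ((ω p₂ 0).toNat - (ω r₂ 0).toNat)) (by omega) (by omega)).1]; omega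
  -- `c > p₁`: if run 3 started left of `p₁` it would stay left of run 1, and run 4 would pass under `ω (p₂+1)`
  have hcp : (p₁ : ℤ) + 1 ≤ ω r₁ 0 := by
    by_contra hcp
    have hdp : ω p₃ 0 < p₁ := by
      by_contra hle
      obtain rfl : e₃ = 1 := by rcases he₃ with rfl | rfl <;> omega
      refine hd13 (p₁ + 1) (r₁ + 1 + (p₁ - (ω r₁ 0).toNat)) le_rfl (by omega) (by omega) (by omega) ?_
      rw [hP1x, (hrun3 (r₁ + 1 + (p₁ - (ω r₁ 0).toNat)) (by omega) (by omega)).1]; omega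
    have hcb : ω r₁ 0 < ω p₂ 0 := by
      by_contra hle
      rcases he₁ with rfl | rfl
      · omega
      refine hd13 (p₁ + 1 + (p₁ - (ω r₁ 0).toNat)) (r₁ + 1) (by omega) (by omega) le_rfl (by omega) ?_
      rw [(hrun1 (p₁ + 1 + (p₁ - (ω r₁ 0).toNat)) (by omega) (by omega)).1, h3s]; omega
    have hdb : ω p₃ 0 < ω p₂ 0 := by
      by_contra hle
      rcases he₁ with rfl | rfl
      · omega
      refine hd13 (p₁ + 1 + (p₁ - (ω p₃ 0).toNat)) p₃ (by omega) (by omega) (by omega) le_rfl ?_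
      rw [(hrun1 (p₁ + 1 + (p₁ - (ω p₃ 0).toNat)) (by omega) (by omega)).1]; omega
    obtain rfl : e₄ = 1 := by rcases he₄ with rfl | rfl <;> omega
    refine hd24 (p₂ + 1) (p₃ + 1 + ((ω p₂ 0).toNat - (ω p₃ 0).toNat)) le_rfl (by omega) (by omega) (by omega) ?_
    have h2s : ω (p₂ + 1) 0 = ω p₂ 0 := by simpa using (hrun2 (p₂ + 1) le_rfl (by omega)).1
    rw [h2s, (hrun4 (p₃ + 1 + ((ω p₂ 0).toNat - (ω p₃ 0).toNat)) (by omega) (by omega)).1]; omega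
  -- `d > p₁`: else run 3, from `c > p₁` down to `d < p₁`, crosses the column `p₁`
  have hdp : (p₁ : ℤ) + 1 ≤ ω p₃ 0 := by
    by_contra hle
    obtain rfl : e₃ = -1 := by rcases he₃ with rfl | rfl <;> omega
    refine hd13 (p₁ + 1) (r₁ + 1 + ((ω r₁ 0).toNat - p₁)) le_rfl (by omega) (by omega) (by omega) ?_
    rw [hP1x, (hrun3 (r₁ + 1 + ((ω r₁ 0).toNat - p₁)) (by omega) (by omega)).1]; omega
  exact ⟨hep, hbg, hbe, hcp, hdp⟩

/-- **A double dip never has its last rise two columns right of its first dive** (any length): with `g = ω r₃ 0 = p₁ + 2`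
the middle row-`−1` run (right of the column `p₁` by `dduduu4_frame`, and missing the column `p₁ + 2` of `ω r₃`) lies right
of the column `p₁ + 2`; the last run, from `e` down to `p₁ + 2`, then forces `e < c` and `e < d`, and the first row-`−2` run,
from `b < e` to `c > e`, passes the site `ω r₂ = (e, −2)`. (The slack-two proof `dduduu_false`, verbatim; there `g = p₁ + 2`
was forced by the slack.) [cite: MadrasSlade1993, §4.2, Definition 4.2.1 (p. 90); §1.2, Definition 1.2.4 (p. 11)]
[cite: EntingJensen2009, §7.4.2, Fig. 7.10] -/
theorem dduduu_gap_two_false {m : ℕ} (hω : ω ∈ ipwb m)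
    {p₁ p₂ p₃ r₁ r₂ r₃ : ℕ} (hD : stepsD m ω = {p₁, p₂, p₃}) (hU : stepsU m ω = {r₁, r₂, r₃}) (h12 : p₁ < p₂)
    (ho1 : p₂ < r₁) (ho2 : r₁ < p₃) (ho3 : p₃ < r₂) (hr23 : r₂ < r₃) (hp1 : 1 ≤ p₁) (hpodd : p₁ % 2 = 1)
    (hR0 : ∀ i, i ≤ p₁ → ω i 0 = i ∧ ω i 1 = 0) (hP1x : ω (p₁ + 1) 0 = p₁) (hP1y : ω (p₁ + 1) 1 = -1)
    (hhor : ∀ i, i < m → i ∉ stepsD m ω → i ∉ stepsU m ω →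
      ω (i + 1) 1 = ω i 1 ∧ (ω (i + 1) 0 = ω i 0 + 1 ∨ ω (i + 1) 0 = ω i 0 - 1))
    (hg : ω r₃ 0 = p₁ + 2) : False := by
  obtain ⟨hpw, -, -⟩ := mem_ipwb.1 hω
  obtain ⟨hw, -⟩ := mem_pwb.1 hpw
  have hinj : Set.InjOn ω {i | i ≤ m} :=
    (mem_saws_iff.1 (mem_hpw.1 (mem_archs.1 (mem_wbr.1 hw).1).1).1).2.2.2
  obtain ⟨e₁, e₂, e₃, e₄, e₅, -, he₂, he₃, -, he₅, hrun1, hrun2, hrun3, hrun4, hrun5, hbev, hcev, hdev, heev, -,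
    hb1, hc1, hd1, he1, hr2, hsm, -, -, -⟩ := dduduu4_runs hω hD hU h12 ho1 ho2 ho3 hr23 hp1 hR0 hP1x hP1y hhor
  obtain ⟨hep, -, hbe, hcp, hdp⟩ :=
    dduduu4_frame hω hD hU h12 ho1 ho2 ho3 hr23 hp1 hpodd hR0 hP1x hP1y hhor (by omega)
  have hb := (hrun1 p₂ (by omega) le_rfl).1
  have hc := (hrun2 r₁ (by omega) le_rfl).1
  have hd := (hrun3 p₃ (by omega) le_rfl).1
  have he := (hrun4 r₂ (by omega) le_rfl).1
  have hg' := (hrun5 r₃ (by omega) le_rfl).1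
  have h3s : ω (r₁ + 1) 0 = ω r₁ 0 := by simpa using (hrun3 (r₁ + 1) le_rfl (by omega)).1
  have hd35 := runs_disjoint hinj (show p₃ < r₂ + 1 by omega) hsm.le hrun3 hrun5
  have hd24 := runs_disjoint hinj (show r₁ < p₃ + 1 by omega) (show r₂ ≤ m by omega) hrun2 hrun4
  -- run 3 does not contain the column `p₁ + 2 = ω r₃ 0`: it lies right of it
  have hc3 : (p₁ : ℤ) + 3 ≤ ω r₁ 0 ∧ (p₁ : ℤ) + 3 ≤ ω p₃ 0 := by
    by_contra hcon
    rcases he₃ with rfl | rfl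
    · refine hd35 (r₁ + 1 + (p₁ + 2 - (ω r₁ 0).toNat)) r₃ (by omega) (by omega) (by omega) le_rfl ?_
      rw [(hrun3 (r₁ + 1 + (p₁ + 2 - (ω r₁ 0).toNat)) (by omega) (by omega)).1, hg]; omega
    · refine hd35 (r₁ + 1 + ((ω r₁ 0).toNat - (p₁ + 2))) r₃ (by omega) (by omega) (by omega) le_rfl ?_
      rw [(hrun3 (r₁ + 1 + ((ω r₁ 0).toNat - (p₁ + 2))) (by omega) (by omega)).1, hg]; omega
  -- run 5, from `e` down to `p₁ + 2`, starts left of `c` and of `d`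
  have hce : ω r₂ 0 < ω r₁ 0 := by
    by_contra hle
    obtain rfl : e₅ = -1 := by rcases he₅ with rfl | rfl <;> omega
    refine hd35 (r₁ + 1) (r₂ + 1 + ((ω r₂ 0).toNat - (ω r₁ 0).toNat)) le_rfl (by omega) (by omega) (by omega) ?_
    rw [h3s, (hrun5 (r₂ + 1 + ((ω r₂ 0).toNat - (ω r₁ 0).toNat)) (by omega) (by omega)).1]; omega
  have hde : ω r₂ 0 < ω p₃ 0 := by
    by_contra hle
    obtain rfl : e₅ = -1 := by rcases he₅ with rfl | rfl <;> omega
    refine hd35 p₃ (r₂ + 1 + ((ω r₂ 0).toNat - (ω p₃ 0).toNat)) (by omega) le_rfl (by omega) (by omega) ?_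
    rw [(hrun5 (r₂ + 1 + ((ω r₂ 0).toNat - (ω p₃ 0).toNat)) (by omega) (by omega)).1]; omega
  -- run 2, from `b < e` to `c > e`, passes the site `ω r₂ = (e, −2)`
  obtain rfl : e₂ = 1 := by rcases he₂ with rfl | rfl <;> omega
  refine hd24 (p₂ + 1 + ((ω r₂ 0).toNat - (ω p₂ 0).toNat)) r₂ (by omega) (by omega) (by omega) le_rfl ?_
  rw [(hrun2 (p₂ + 1 + ((ω r₂ 0).toNat - (ω p₂ 0).toNat)) (by omega) (by omega)).1]; omega

/-! ### §4  The gap four: the W-shape -/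

/-- **Gap four, first half** (any length): with `g = ω r₃ 0 = p₁ + 4` the middle row-`−1` run (right of the column `p₁`, and
missing the column `p₁ + 4` of `ω r₃`) does not lie right of `p₁ + 4` — else, as for the gap two, the last run forces `e < c`,
`e < d` and the first row-`−2` run passes `ω r₂` — so both its end columns are `p₁ + 1` or `p₁ + 3`.
[cite: MadrasSlade1993, §4.2, Definition 4.2.1 (p. 90); §1.2, Definition 1.2.4 (p. 11)] [cite: EntingJensen2009, §7.4.2, Fig. 7.10] -/
theorem dduduu_gap_four_mid {m : ℕ} (hω : ω ∈ ipwb m)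
    {p₁ p₂ p₃ r₁ r₂ r₃ : ℕ} (hD : stepsD m ω = {p₁, p₂, p₃}) (hU : stepsU m ω = {r₁, r₂, r₃}) (h12 : p₁ < p₂)
    (ho1 : p₂ < r₁) (ho2 : r₁ < p₃) (ho3 : p₃ < r₂) (hr23 : r₂ < r₃) (hp1 : 1 ≤ p₁) (hpodd : p₁ % 2 = 1)
    (hR0 : ∀ i, i ≤ p₁ → ω i 0 = i ∧ ω i 1 = 0) (hP1x : ω (p₁ + 1) 0 = p₁) (hP1y : ω (p₁ + 1) 1 = -1)
    (hhor : ∀ i, i < m → i ∉ stepsD m ω → i ∉ stepsU m ω →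
      ω (i + 1) 1 = ω i 1 ∧ (ω (i + 1) 0 = ω i 0 + 1 ∨ ω (i + 1) 0 = ω i 0 - 1))
    (hg : ω r₃ 0 = p₁ + 4) : ω r₁ 0 ≤ p₁ + 3 ∧ ω p₃ 0 ≤ p₁ + 3 := by
  obtain ⟨hpw, -, -⟩ := mem_ipwb.1 hω
  obtain ⟨hw, -⟩ := mem_pwb.1 hpw
  have hinj : Set.InjOn ω {i | i ≤ m} :=
    (mem_saws_iff.1 (mem_hpw.1 (mem_archs.1 (mem_wbr.1 hw).1).1).1).2.2.2
  obtain ⟨e₁, e₂, e₃, e₄, e₅, -, he₂, he₃, -, he₅, hrun1, hrun2, hrun3, hrun4, hrun5, hbev, hcev, hdev, heev, -,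
    hb1, hc1, hd1, he1, hr2, hsm, -, -, -⟩ := dduduu4_runs hω hD hU h12 ho1 ho2 ho3 hr23 hp1 hR0 hP1x hP1y hhor
  obtain ⟨hep, -, hbe, hcp, hdp⟩ :=
    dduduu4_frame hω hD hU h12 ho1 ho2 ho3 hr23 hp1 hpodd hR0 hP1x hP1y hhor (by omega)
  have hb := (hrun1 p₂ (by omega) le_rfl).1
  have hc := (hrun2 r₁ (by omega) le_rfl).1
  have hd := (hrun3 p₃ (by omega) le_rfl).1
  have he := (hrun4 r₂ (by omega) le_rfl).1
  have hg' := (hrun5 r₃ (by omega) le_rfl).1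
  have h3s : ω (r₁ + 1) 0 = ω r₁ 0 := by simpa using (hrun3 (r₁ + 1) le_rfl (by omega)).1
  have hd35 := runs_disjoint hinj (show p₃ < r₂ + 1 by omega) hsm.le hrun3 hrun5
  have hd24 := runs_disjoint hinj (show r₁ < p₃ + 1 by omega) (show r₂ ≤ m by omega) hrun2 hrun4
  -- run 3 does not lie right of the column `p₁ + 4`
  have hfar : ¬ ((p₁ : ℤ) + 5 ≤ ω r₁ 0 ∧ (p₁ : ℤ) + 5 ≤ ω p₃ 0) := by
    rintro ⟨hc5, hd5⟩
    have hce : ω r₂ 0 < ω r₁ 0 := by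
      by_contra hle
      obtain rfl : e₅ = -1 := by rcases he₅ with rfl | rfl <;> omega
      refine hd35 (r₁ + 1) (r₂ + 1 + ((ω r₂ 0).toNat - (ω r₁ 0).toNat)) le_rfl (by omega) (by omega) (by omega) ?_
      rw [h3s, (hrun5 (r₂ + 1 + ((ω r₂ 0).toNat - (ω r₁ 0).toNat)) (by omega) (by omega)).1]; omega
    have hde : ω r₂ 0 < ω p₃ 0 := by
      by_contra hle
      obtain rfl : e₅ = -1 := by rcases he₅ with rfl | rfl <;> omega
      refine hd35 p₃ (r₂ + 1 + ((ω r₂ 0).toNat - (ω p₃ 0).toNat)) (by omega) le_rfl (by omega) (by omega) ?_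
      rw [(hrun5 (r₂ + 1 + ((ω r₂ 0).toNat - (ω p₃ 0).toNat)) (by omega) (by omega)).1]; omega
    obtain rfl : e₂ = 1 := by rcases he₂ with rfl | rfl <;> omega
    refine hd24 (p₂ + 1 + ((ω r₂ 0).toNat - (ω p₂ 0).toNat)) r₂ (by omega) (by omega) (by omega) le_rfl ?_
    rw [(hrun2 (p₂ + 1 + ((ω r₂ 0).toNat - (ω p₂ 0).toNat)) (by omega) (by omega)).1]; omega
  -- and it does not pass the column `p₁ + 4` of `ω r₃`
  by_contra hcon
  rcases he₃ with rfl | rfl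
  · refine hd35 (r₁ + 1 + (p₁ + 4 - (ω r₁ 0).toNat)) r₃ (by omega) (by omega) (by omega) le_rfl ?_
    rw [(hrun3 (r₁ + 1 + (p₁ + 4 - (ω r₁ 0).toNat)) (by omega) (by omega)).1, hg]; omega
  · refine hd35 (r₁ + 1 + ((ω r₁ 0).toNat - (p₁ + 4))) r₃ (by omega) (by omega) (by omega) le_rfl ?_
    rw [(hrun3 (r₁ + 1 + ((ω r₁ 0).toNat - (p₁ + 4))) (by omega) (by omega)).1, hg]; omega

/-- **The W-shape of a double dip with gap four** (any length): if the last rise of a `D D U D U U` block is four columns right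
of its first dive (`ω r₃ 0 = p₁ + 4`), then the first row-`−1` run goes LEFT, to a column `b = ω p₂ 0 ≤ p₁ − 1`; the first
row-`−2` run goes right to `c = ω r₁ 0 = p₁ + 1`; the middle row-`−1` run is the two steps to `d = ω p₃ 0 = p₁ + 3`
(`p₃ = r₁ + 3`); the second row-`−2` run goes right to a column `e = ω r₂ 0 ≥ p₁ + 5`; the last row-`−1` run comes back left to
`p₁ + 4`; and the step count between the first dive and the last rise reads `r₃ + 2b = p₁ + 2e + 1`. (By `dduduu_gap_four_mid`
the middle run lives in the columns `p₁ + 1`, `p₁ + 3`; it cannot go left, from `p₁ + 3` to `p₁ + 1`, for then `b ≤ p₁ − 1` and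
the first row-`−2` run, from `b` right to `p₁ + 3`, would pass the site `ω (p₃+1) = (p₁+1, −2)`; the columns `b` and `e` avoid
`c`, `d` by self-avoidance on the rows `−1`, which fixes all five velocities.) This shape is realised at slack six.
[cite: MadrasSlade1993, §4.2, Definition 4.2.1 (p. 90); §1.2, Definition 1.2.4 (p. 11)] [cite: EntingJensen2009, §7.4.2, Fig. 7.10] -/
theorem dduduu_gap_four {m : ℕ} (hω : ω ∈ ipwb m)
    {p₁ p₂ p₃ r₁ r₂ r₃ : ℕ} (hD : stepsD m ω = {p₁, p₂, p₃}) (hU : stepsU m ω = {r₁, r₂, r₃}) (h12 : p₁ < p₂)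
    (ho1 : p₂ < r₁) (ho2 : r₁ < p₃) (ho3 : p₃ < r₂) (hr23 : r₂ < r₃) (hp1 : 1 ≤ p₁) (hpodd : p₁ % 2 = 1)
    (hR0 : ∀ i, i ≤ p₁ → ω i 0 = i ∧ ω i 1 = 0) (hP1x : ω (p₁ + 1) 0 = p₁) (hP1y : ω (p₁ + 1) 1 = -1)
    (hhor : ∀ i, i < m → i ∉ stepsD m ω → i ∉ stepsU m ω →
      ω (i + 1) 1 = ω i 1 ∧ (ω (i + 1) 0 = ω i 0 + 1 ∨ ω (i + 1) 0 = ω i 0 - 1))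
    (hg : ω r₃ 0 = p₁ + 4) :
    ω p₂ 0 + 1 ≤ p₁ ∧ ω r₁ 0 = p₁ + 1 ∧ ω p₃ 0 = p₁ + 3 ∧ (p₁ : ℤ) + 5 ≤ ω r₂ 0 ∧ p₃ = r₁ + 3 ∧
      (r₃ : ℤ) + 2 * ω p₂ 0 = p₁ + 2 * ω r₂ 0 + 1 ∧ ω p₂ 0 % 2 = 0 ∧ ω r₂ 0 % 2 = 0 := by
  obtain ⟨hpw, -, -⟩ := mem_ipwb.1 hω
  obtain ⟨hw, -⟩ := mem_pwb.1 hpw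
  have hinj : Set.InjOn ω {i | i ≤ m} :=
    (mem_saws_iff.1 (mem_hpw.1 (mem_archs.1 (mem_wbr.1 hw).1).1).1).2.2.2
  obtain ⟨e₁, e₂, e₃, e₄, e₅, he₁, he₂, he₃, he₄, he₅, hrun1, hrun2, hrun3, hrun4, hrun5, hbev, hcev, hdev, heev, -,
    hb1, hc1, hd1, he1, hr2, hsm, -, -, -⟩ := dduduu4_runs hω hD hU h12 ho1 ho2 ho3 hr23 hp1 hR0 hP1x hP1y hhor
  obtain ⟨hep, hbg, hbe, hcp, hdp⟩ :=
    dduduu4_frame hω hD hU h12 ho1 ho2 ho3 hr23 hp1 hpodd hR0 hP1x hP1y hhor (by omega)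
  obtain ⟨hc3, hd3⟩ := dduduu_gap_four_mid hω hD hU h12 ho1 ho2 ho3 hr23 hp1 hpodd hR0 hP1x hP1y hhor hg
  have hb := (hrun1 p₂ (by omega) le_rfl).1
  have hc := (hrun2 r₁ (by omega) le_rfl).1
  have hd := (hrun3 p₃ (by omega) le_rfl).1
  have he := (hrun4 r₂ (by omega) le_rfl).1
  have hg' := (hrun5 r₃ (by omega) le_rfl).1
  have h3s : ω (r₁ + 1) 0 = ω r₁ 0 := by simpa using (hrun3 (r₁ + 1) le_rfl (by omega)).1
  have h4s : ω (p₃ + 1) 0 = ω p₃ 0 := by simpa using (hrun4 (p₃ + 1) le_rfl (by omega)).1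
  have h5s : ω (r₂ + 1) 0 = ω r₂ 0 := by simpa using (hrun5 (r₂ + 1) le_rfl (by omega)).1
  have hd13 := runs_disjoint hinj (show p₂ < r₁ + 1 by omega) (show p₃ ≤ m by omega) hrun1 hrun3
  have hd35 := runs_disjoint hinj (show p₃ < r₂ + 1 by omega) hsm.le hrun3 hrun5
  have hd24 := runs_disjoint hinj (show r₁ < p₃ + 1 by omega) (show r₂ ≤ m by omega) hrun2 hrun4
  -- the end `ω p₂` of run 1 is not a site of run 3, and the two ends of run 3 differ
  have hb3 : ω p₂ 0 ≠ ω r₁ 0 := fun h => hd13 p₂ (r₁ + 1) (by omega) le_rfl le_rfl (by omega) (by rw [h3s]; exact h)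
  have hb4 : ω p₂ 0 ≠ ω p₃ 0 := fun h => hd13 p₂ p₃ (by omega) le_rfl (by omega) le_rfl h
  have h34 : ω r₁ 0 ≠ ω p₃ 0 := by rcases he₃ with rfl | rfl <;> omega
  -- run 3 goes right (`c = p₁ + 1`, `d = p₁ + 3`): else run 2, from `b ≤ p₁ − 1` right to `p₁ + 3`, passes `ω (p₃+1)`
  have hcd : ω r₁ 0 < ω p₃ 0 := by
    by_contra hle
    obtain rfl : e₂ = 1 := by rcases he₂ with rfl | rfl <;> omega
    refine hd24 (p₂ + 1 + ((ω p₃ 0).toNat - (ω p₂ 0).toNat)) (p₃ + 1) (by omega) (by omega) le_rfl (by omega) ?_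
    rw [(hrun2 (p₂ + 1 + ((ω p₃ 0).toNat - (ω p₂ 0).toNat)) (by omega) (by omega)).1, h4s]; omega
  obtain rfl : e₃ = 1 := by rcases he₃ with rfl | rfl <;> omega
  -- the start `ω (r₂+1)` of run 5 is not a site of run 3: `e ≥ p₁ + 5`
  have he3 : ω r₂ 0 ≠ ω r₁ 0 := fun h =>
    hd35 (r₁ + 1) (r₂ + 1) le_rfl (by omega) le_rfl (by omega) (by rw [h3s, h5s]; exact h.symm)
  have he4 : ω r₂ 0 ≠ ω p₃ 0 := fun h => hd35 p₃ (r₂ + 1) (by omega) le_rfl le_rfl (by omega) (by rw [h5s]; exact h.symm)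
  obtain rfl : e₁ = -1 := by rcases he₁ with rfl | rfl <;> omega
  obtain rfl : e₂ = 1 := by rcases he₂ with rfl | rfl <;> omega
  obtain rfl : e₄ = 1 := by rcases he₄ with rfl | rfl <;> omega
  obtain rfl : e₅ = -1 := by rcases he₅ with rfl | rfl <;> omega
  exact ⟨by omega, by omega, by omega, by omega, by omega, by omega, hbev, heev⟩

/-! ### §5  Slack four: the double dip never occurs -/

/-- **The order `D D U D U U` never occurs at slack four.** An irreducible positive wall bridge of length `6k + 4` with `k`
surface visits (`k ≥ 2`) whose down steps `p₁ < p₂ < p₃` and up steps `r₁ < r₂ < r₃` come in the order `p₂ < r₁ < p₃ < r₂`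
does not exist: by `dduduu4_exit` its last rise is at the column `p₁ + 2` (impossible at any length, `dduduu_gap_two_false`)
or `p₁ + 4`, where the W-shape of `dduduu_gap_four` and `r₃ = 4k + 3 + p₁` give `e − b = 2k + 1` for the even columns `b`,
`e`. (The lane's enumeration of `ipwb (6k+4)` with `k` visits, `2 ≤ k ≤ 15`, has no such block; at slack six they exist.)
[cite: MadrasSlade1993, §4.2, Definition 4.2.1 (p. 90) and remark before (4.2.21) (p. 94); §1.2, Definition 1.2.4 (p. 11)]
[cite: EntingJensen2009, §7.4.2, Fig. 7.10] [cite: BeatonBousquetMelouDeGierDuminilCopinGuttmann2014, §3.1 (arXiv v5 p. 8)] -/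
theorem dduduu_slack_four_false {k m : ℕ} (hk : 2 ≤ k) (hm : m = 6 * k + 4) (hω : ω ∈ ipwb m) (hv : visits m ω = k)
    {p₁ p₂ p₃ r₁ r₂ r₃ : ℕ} (hD : stepsD m ω = {p₁, p₂, p₃}) (hU : stepsU m ω = {r₁, r₂, r₃}) (h12 : p₁ < p₂)
    (ho1 : p₂ < r₁) (ho2 : r₁ < p₃) (ho3 : p₃ < r₂) (hr23 : r₂ < r₃) : False := by
  classical
  have hcD : #(stepsD m ω) = 3 := by
    rw [hD, Finset.card_insert_of_notMem (by simp; omega), Finset.card_insert_of_notMem (by simp; omega),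
      Finset.card_singleton]
  have hcU : #(stepsU m ω) = 3 := by rw [card_stepsU_eq_card_stepsD hω (by omega), hcD]
  obtain ⟨q₁, q₂, q₃, s₁, s₂, s₃, hD', -, hq12, hq23, -, -, -, -, -, hq1, hqodd, hR0, hQ1x, hQ1y, hhor, -⟩ :=
    profile_of_card_stepsD_eq_three hω hcD hcU
  -- the first dive of the profile is `p₁`
  obtain rfl : q₁ = p₁ := by
    have h1 : p₁ ∈ stepsD m ω := by rw [hD]; simp
    have h2 : q₁ ∈ stepsD m ω := by rw [hD']; simp
    rw [hD'] at h1
    rw [hD] at h2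
    simp only [Finset.mem_insert, Finset.mem_singleton] at h1 h2
    omega
  obtain ⟨e₁, e₂, e₃, e₄, e₅, -, -, -, -, -, -, -, -, -, -, -, -, -, -, hgodd, -, -, -, -, -, hsm, hsev, hvf, hX⟩ :=
    dduduu4_runs hω hD hU h12 ho1 ho2 ho3 hr23 hq1 hR0 hQ1x hQ1y hhor
  obtain ⟨hg | hg, hr3⟩ := dduduu4_exit hk hm hω hv hD h12 (by omega) hqodd hsev hsm hgodd hvf hX
  · exact dduduu_gap_two_false hω hD hU h12 ho1 ho2 ho3 hr23 hq1 hqodd hR0 hQ1x hQ1y hhor hg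
  · obtain ⟨-, -, -, -, -, ht, hbev, heev⟩ := dduduu_gap_four hω hD hU h12 ho1 ho2 ho3 hr23 hq1 hqodd hR0 hQ1x hQ1y hhor hg
    omega

end Literature.Probability.RandomPlanarGeometry.SAW.HexBW.Wall
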